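import Summits.BirchSwinnertonDyer.Rank1Residual.GaloisImage.AdditiveReductionLangLift
import Literature.NumberTheory.EllipticCurves.PeriodIndexSupportProofs
import HarnessLib

/-!
# Crossed homomorphisms `Γ_{K_v} → E(K̄_v)` vanishing on inertia WITH VALUES IN `E₀(K_v)` are
# principal — at an ADDITIVE (cuspidal) place
# (cell `b2b-bsdres`, team n1011, seat p10 GEN 8; THEOREM A programme, FILE 7c; plan
# `HOME/b2b-bsdres-n1011-p10/g8/THEOREM-A-PLAN.md`)

HONEST FRAMING (cell `b2b-bsdres`, run/shared/lean/b2b/bsd-rank1-residual/, verbatim in every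
file): the goal of the cell is to DELETE the COMBINATION-SHAPED residual classes of the
Birch–Swinnerton-Dyer formula for ALL analytic-rank `≤ 1` elliptic curves over `ℚ` — "full BSD
formula for every rank `≤ 1` curve in class `C`" assembled STRICTLY from published theorems — so
that the rank-`≤ 1` remainder becomes exactly the CONSTRUCTION-SHAPED classes, which are TYPED
(missing-input `Prop`s), NOT attempted. This is not "finishing BSD". Team n1011 (N10 / N11):
research route on the CONSTRUCTION-SHAPED class X4 (§I N11 LOWER half); no claim beyond the stated
classes; nothing is booked; marks UNCHANGED. Theorems only: no definition, no named fact, no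
`sorry`. TOOL theorems; they close nothing by themselves.

## What

`exists_eq_map_sub_of_cocycle_of_cusp`: the tree's
`WeierstrassCurve.exists_eq_map_sub_of_cocycle` (Milne, *ADT*, I.3.8 in cocycle form, GOOD
reduction: a crossed homomorphism `g : Γ_{K_v} → V(K̄_v)` with open zero set vanishing on the
inertia group `I_𝔐` is principal) carried to an ADDITIVE place `v` whose reduction is the cuspidal
singular model `singularModel x₀ y₀ α α` (`x₀, y₀, α ∈ k_v`), under the extra hypothesis that EVERY
VALUE `g σ` is `O` or the image of an integral `K_v`-point of the minimal model with NONSINGULAR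
reduction (`g` takes values in the image of `E₀(K_v)`; e.g. `g σ = χ(σ) • T` for an unramified
character `χ` and `T ∈ E₀(K_v)[p]` — THEOREM A, FILE 7d). The proof is the tree's, verbatim
(`F`-power bookkeeping, the layer `K_n = K_v(ζ_{qⁿ−1})`, successive approximation in `V₁(K_n)` by
`FormalGroupChart.exists_map_sub_eq_of_sum_eq_zero`, density of `⟨F, I⟩`), with its Step 1
(Lang + Hensel at good reduction) replaced by FILE 7b `exists_lift_sub_mem_kernel_of_cusp`.
Identity-component hypothesis is where the Néron component group would obstruct: for `T ∉ E₀`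
the statement is false (L41-NOTE §7 (a)).

References: [MilneADT2006] Ch. I Prop. 3.8 (proof); Lang–Tate 1958; [SilvermanAEC2009] VII.2.1.
-/

noncomputable section

open scoped Classical NNReal Topology
open NumberField IsDedekindDomain Field Polynomial ValuativeRel

universe u

namespace Summit.BirchSwinnertonDyer.Rank1Residual.GaloisImage.TwistedWitness

open WeierstrassCurve Literature.NumberTheory.EllipticCurves Literature.NumberTheory.EllipticCurves.FormalGroupChart
  Literature.NumberTheory.GaloisRepresentations
  Literature.NumberTheory.GaloisRepresentations.IsNonarchimedeanLocalField IsDedekindDomain.HeightOneSpectrum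

variable {K : Type u} [Field K] [NumberField K] {v : HeightOneSpectrum (𝓞 K)}
  {w : Valuation (AlgebraicClosure (v.adicCompletion K)) ℝ≥0}
  (M : WeierstrassCurve (v.adicCompletionIntegers K))
  (hw : ∀ x, (w x : ℝ) = spectralNorm (v.adicCompletion K) (AlgebraicClosure (v.adicCompletion K)) x)

include hw in
set_option maxHeartbeats 1600000 in
/-- **Crossed homomorphisms `Γ_{K_v} → V(K̄_v)` with open zero set, vanishing on the inertia group
and with values in (the image of) `E₀(K_v)`, are principal at an additive (cuspidal) place** —
the cocycle form of Milne, *ADT*, I.3.8 with the identity component in place of good reduction.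
`V = M ⊗ K̄_v`, `M` the minimal model; `M.map (IsLocalRing.residue (v.adicCompletionIntegers K)) = singularModel x₀ y₀ α α`.
[cite: MilneADT2006, Ch. I Prop. 3.8 (proof)] [cite: SilvermanAEC2009, Prop. VII.2.1] -/
theorem exists_eq_map_sub_of_cocycle_of_cusp
    [hMell : (M.map (algebraMap (v.adicCompletionIntegers K) (v.adicCompletion K))).IsElliptic]
    (x₀ y₀ α : IsLocalRing.ResidueField (v.adicCompletionIntegers K))
    (hcusp : M.map (IsLocalRing.residue (v.adicCompletionIntegers K)) = singularModel x₀ y₀ α α)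
    {𝔐 : Ideal v.localAbsIntegers} (h𝔐 : 𝔐 ∈ v.localPrimesAbove)
    [hV : (((M.map (algebraMap (v.adicCompletionIntegers K) (v.adicCompletion K))).baseChange (AlgebraicClosure (v.adicCompletion K)))).IsIntegral w.integer]
    (g : absoluteGaloisGroup (v.adicCompletion K) → (((M.map (algebraMap (v.adicCompletionIntegers K) (v.adicCompletion K))).baseChange (AlgebraicClosure (v.adicCompletion K)))).toAffine.Point)
    (hg : ∀ σ τ, g (σ * τ) = g σ + WeierstrassCurve.Affine.Point.map (W' := M.map (algebraMap (v.adicCompletionIntegers K) (v.adicCompletion K))) ((absoluteGaloisGroup.toAlgEquiv (v.adicCompletion K) (σ) : AlgebraicClosure (v.adicCompletion K) ≃ₐ[v.adicCompletion K] AlgebraicClosure (v.adicCompletion K)) : AlgebraicClosure (v.adicCompletion K) →ₐ[v.adicCompletion K] AlgebraicClosure (v.adicCompletion K)) (g τ))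
    (hopen : IsOpen {σ | g σ = 0})
    (hI : ∀ τ ∈ 𝔐.inertia (absoluteGaloisGroup (v.adicCompletion K)), g τ = 0)
    (hgE0 : ∀ σ, g σ = 0 ∨ ∃ (a₀ b₀ : v.adicCompletionIntegers K)
      (_ : (M.map (IsLocalRing.residue (v.adicCompletionIntegers K))).toAffine.Nonsingular
        (IsLocalRing.residue (v.adicCompletionIntegers K) a₀)
        (IsLocalRing.residue (v.adicCompletionIntegers K) b₀))
      (hm : (((M.map (algebraMap (v.adicCompletionIntegers K) (v.adicCompletion K))).baseChange (AlgebraicClosure (v.adicCompletion K)))).toAffine.Nonsingular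
        (algebraMap (v.adicCompletionIntegers K) (AlgebraicClosure (v.adicCompletion K)) a₀)
        (algebraMap (v.adicCompletionIntegers K) (AlgebraicClosure (v.adicCompletion K)) b₀)),
      g σ = .some _ _ hm) :
    ∃ P : (((M.map (algebraMap (v.adicCompletionIntegers K) (v.adicCompletion K))).baseChange (AlgebraicClosure (v.adicCompletion K)))).toAffine.Point, ∀ σ, g σ = WeierstrassCurve.Affine.Point.map (W' := M.map (algebraMap (v.adicCompletionIntegers K) (v.adicCompletion K))) ((absoluteGaloisGroup.toAlgEquiv (v.adicCompletion K) (σ) : AlgebraicClosure (v.adicCompletion K) ≃ₐ[v.adicCompletion K] AlgebraicClosure (v.adicCompletion K)) : AlgebraicClosure (v.adicCompletion K) →ₐ[v.adicCompletion K] AlgebraicClosure (v.adicCompletion K)) P - P := by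
  have hq2 := two_le_natCard_residueField (K := K) (v := v)
  haveI hVell : (((M.map (algebraMap (v.adicCompletionIntegers K) (v.adicCompletion K))).baseChange (AlgebraicClosure (v.adicCompletion K)))).IsElliptic :=
    inferInstance
  haveI hInormal : (𝔐.inertia (absoluteGaloisGroup (v.adicCompletion K))).Normal := inertia_normal_of_mem_localPrimesAbove v h𝔐
  -- a local arithmetic Frobenius `F`
  obtain ⟨F, hF⟩ := exists_isArithFrobAt_localAbsIntegers (v := v) h𝔐
  have hφq : ∀ z : (AlgebraicClosure (v.adicCompletion K)), w z ≤ 1 → w ((absoluteGaloisGroup.toAlgEquiv (v.adicCompletion K)) F z - z ^ (Nat.card (IsLocalRing.ResidueField (v.adicCompletionIntegers K)))) < 1 :=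
    fun z hz ↦ spectralValuation_frobenius_sub_pow_lt_one hw h𝔐 hF hz
  have hFw : ∀ z : (AlgebraicClosure (v.adicCompletion K)), w ((absoluteGaloisGroup.toAlgEquiv (v.adicCompletion K)) F z) = w z := fun z ↦ spectralValuation_smul hw F z
  have hσw : ∀ (σ : absoluteGaloisGroup (v.adicCompletion K)) (z : (AlgebraicClosure (v.adicCompletion K))), w ((absoluteGaloisGroup.toAlgEquiv (v.adicCompletion K)) σ z) = w z :=
    fun σ z ↦ spectralValuation_smul hw σ z
  -- Step 1 (Lang + Hensel): `m₁ = g F - (F b - b) ∈ V₁` with `b` fixed by `I`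
  obtain ⟨b, hbI, hm₁⟩ : ∃ b : (((M.map (algebraMap (v.adicCompletionIntegers K) (v.adicCompletion K))).baseChange (AlgebraicClosure (v.adicCompletion K)))).toAffine.Point,
      (∀ τ ∈ 𝔐.inertia (absoluteGaloisGroup (v.adicCompletion K)), WeierstrassCurve.Affine.Point.map (W' := M.map (algebraMap (v.adicCompletionIntegers K) (v.adicCompletion K))) ((absoluteGaloisGroup.toAlgEquiv (v.adicCompletion K) (τ) : AlgebraicClosure (v.adicCompletion K) ≃ₐ[v.adicCompletion K] AlgebraicClosure (v.adicCompletion K)) : AlgebraicClosure (v.adicCompletion K) →ₐ[v.adicCompletion K] AlgebraicClosure (v.adicCompletion K)) b = b) ∧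
      g F - (WeierstrassCurve.Affine.Point.map (W' := M.map (algebraMap (v.adicCompletionIntegers K) (v.adicCompletion K))) ((absoluteGaloisGroup.toAlgEquiv (v.adicCompletion K) (F) : AlgebraicClosure (v.adicCompletion K) ≃ₐ[v.adicCompletion K] AlgebraicClosure (v.adicCompletion K)) : AlgebraicClosure (v.adicCompletion K) →ₐ[v.adicCompletion K] AlgebraicClosure (v.adicCompletion K)) b - b) ∈ kernel w (((M.map (algebraMap (v.adicCompletionIntegers K) (v.adicCompletion K))).baseChange (AlgebraicClosure (v.adicCompletion K)))) := by
    rcases hgE0 F with h0 | ⟨a₀, b₀, hns₀, hm, hgF⟩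
    · refine ⟨0, fun τ _ ↦ by rw [map_zero], ?_⟩
      rw [h0, map_zero, sub_self, sub_zero]
      exact (kernel w _).zero_mem
    · rw [hgF]
      exact exists_lift_sub_mem_kernel_of_cusp hw h𝔐 x₀ y₀ α hcusp hφq hns₀ hm
  set g₁ : absoluteGaloisGroup (v.adicCompletion K) → (((M.map (algebraMap (v.adicCompletionIntegers K) (v.adicCompletion K))).baseChange (AlgebraicClosure (v.adicCompletion K)))).toAffine.Point := fun σ ↦ g σ - (WeierstrassCurve.Affine.Point.map (W' := M.map (algebraMap (v.adicCompletionIntegers K) (v.adicCompletion K))) ((absoluteGaloisGroup.toAlgEquiv (v.adicCompletion K) (σ) : AlgebraicClosure (v.adicCompletion K) ≃ₐ[v.adicCompletion K] AlgebraicClosure (v.adicCompletion K)) : AlgebraicClosure (v.adicCompletion K) →ₐ[v.adicCompletion K] AlgebraicClosure (v.adicCompletion K)) b - b) with hg₁def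
  have hg₁ : ∀ σ τ, g₁ (σ * τ) = g₁ σ + WeierstrassCurve.Affine.Point.map (W' := M.map (algebraMap (v.adicCompletionIntegers K) (v.adicCompletion K))) ((absoluteGaloisGroup.toAlgEquiv (v.adicCompletion K) (σ) : AlgebraicClosure (v.adicCompletion K) ≃ₐ[v.adicCompletion K] AlgebraicClosure (v.adicCompletion K)) : AlgebraicClosure (v.adicCompletion K) →ₐ[v.adicCompletion K] AlgebraicClosure (v.adicCompletion K)) (g₁ τ) := cocycle_sub_coboundary hg b
  have hg₁I : ∀ τ ∈ 𝔐.inertia (absoluteGaloisGroup (v.adicCompletion K)), g₁ τ = 0 := fun τ hτ ↦ by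
    simp only [hg₁def, hI τ hτ, hbI τ hτ, sub_self]
  have hg₁open : IsOpen {σ | g₁ σ = 0} := isOpen_setOf_sub_coboundary_eq_zero hg hopen b
  have hm₁K : g₁ F ∈ kernel w ((M.map (algebraMap (v.adicCompletionIntegers K) (v.adicCompletion K))).baseChange (AlgebraicClosure (v.adicCompletion K))) := hm₁
  -- `m₁` is fixed by `I`
  have hm₁I : ∀ τ ∈ 𝔐.inertia (absoluteGaloisGroup (v.adicCompletion K)), WeierstrassCurve.Affine.Point.map (W' := M.map (algebraMap (v.adicCompletionIntegers K) (v.adicCompletion K))) ((absoluteGaloisGroup.toAlgEquiv (v.adicCompletion K) (τ) : AlgebraicClosure (v.adicCompletion K) ≃ₐ[v.adicCompletion K] AlgebraicClosure (v.adicCompletion K)) : AlgebraicClosure (v.adicCompletion K) →ₐ[v.adicCompletion K] AlgebraicClosure (v.adicCompletion K)) (g₁ F) = g₁ F := by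
    intro τ hτ
    have hτ' : F⁻¹ * τ * F ∈ 𝔐.inertia (absoluteGaloisGroup (v.adicCompletion K)) := by
      have := hInormal.conj_mem τ hτ F⁻¹
      rwa [inv_inv] at this
    have h1 : g₁ (τ * F) = WeierstrassCurve.Affine.Point.map (W' := M.map (algebraMap (v.adicCompletionIntegers K) (v.adicCompletion K))) ((absoluteGaloisGroup.toAlgEquiv (v.adicCompletion K) (τ) : AlgebraicClosure (v.adicCompletion K) ≃ₐ[v.adicCompletion K] AlgebraicClosure (v.adicCompletion K)) : AlgebraicClosure (v.adicCompletion K) →ₐ[v.adicCompletion K] AlgebraicClosure (v.adicCompletion K)) (g₁ F) := by rw [hg₁, hg₁I τ hτ, zero_add]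
    have h2 : g₁ (F * (F⁻¹ * τ * F)) = g₁ F := by rw [hg₁, hg₁I _ hτ', map_zero, add_zero]
    rw [← h1, show τ * F = F * (F⁻¹ * τ * F) by group, h2]
  -- the coordinates of `m₁` lie in `K_v^nr`
  set m₁ := g₁ F with hm₁def
  have hcoordI : ∀ z : (AlgebraicClosure (v.adicCompletion K)), (∀ τ ∈ 𝔐.inertia (absoluteGaloisGroup (v.adicCompletion K)), (absoluteGaloisGroup.toAlgEquiv (v.adicCompletion K)) τ z = z) →
      z ∈ maxUnramified (v.adicCompletion K) := fun z hz ↦ (mem_maxUnramified_iff_forall_inertia hw h𝔐).mpr hz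
  -- Step 2: the level `n`
  -- (a) an open normal subgroup of finite index inside the zero set of `g₁`
  have hS₁ : {σ | g₁ σ = 0} ∈ 𝓝 (1 : absoluteGaloisGroup (v.adicCompletion K)) := hg₁open.mem_nhds (cocycle_apply_one hg₁)
  haveI := isGalois_algebraicClosure_adicCompletion (v := v)
  obtain ⟨L₀, hL₀fin, hL₀normal, hL₀sub⟩ :=
    (krullTopology_mem_nhds_one_iff_of_normal (v.adicCompletion K) (AlgebraicClosure (v.adicCompletion K)) {σ | g₁ σ = 0}).mp hS₁
  haveI := hL₀fin
  haveI := hL₀normal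
  set m₀ : ℕ := orderOf (AlgEquiv.restrictNormalHom L₀ ((absoluteGaloisGroup.toAlgEquiv (v.adicCompletion K)) F)) with hm₀def
  have hm₀pos : 0 < m₀ := orderOf_pos _
  have hFpow : ∀ k : ℕ, g₁ (F ^ (m₀ * k)) = 0 := by
    intro k
    apply hL₀sub
    change ((absoluteGaloisGroup.toAlgEquiv (v.adicCompletion K)) (F ^ (m₀ * k)) : (AlgebraicClosure (v.adicCompletion K)) ≃ₐ[(v.adicCompletion K)] (AlgebraicClosure (v.adicCompletion K))) ∈ (L₀.fixingSubgroup : Set ((AlgebraicClosure (v.adicCompletion K)) ≃ₐ[(v.adicCompletion K)] (AlgebraicClosure (v.adicCompletion K))))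
    rw [SetLike.mem_coe, ← IntermediateField.restrictNormalHom_ker, MonoidHom.mem_ker, map_pow, map_pow,
      pow_mul, pow_orderOf_eq_one, one_pow]
  -- (b) the roots of unity generating a field containing the coordinates of `m₁`
  obtain ⟨T, hTsub, hTgen⟩ : ∃ T : Finset (AlgebraicClosure (v.adicCompletion K)), (↑T : Set (AlgebraicClosure (v.adicCompletion K))) ⊆ primeToPRootsOfUnity (v.adicCompletion K) ∧
      ∀ z : (AlgebraicClosure (v.adicCompletion K)), (∃ x y h, m₁ = .some x y h ∧ (z = x ∨ z = y)) → z ∈ IntermediateField.adjoin (v.adicCompletion K) (↑T : Set (AlgebraicClosure (v.adicCompletion K))) := by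
    rcases hm : m₁ with _ | ⟨x₁, y₁, h₁⟩
    · exact ⟨∅, by simp, fun z ⟨x, y, h, he, _⟩ ↦ by cases he⟩
    · have hfix : ∀ τ ∈ 𝔐.inertia (absoluteGaloisGroup (v.adicCompletion K)), (absoluteGaloisGroup.toAlgEquiv (v.adicCompletion K)) τ x₁ = x₁ ∧ (absoluteGaloisGroup.toAlgEquiv (v.adicCompletion K)) τ y₁ = y₁ := by
        intro τ hτ
        have := hm₁I τ hτ
        rw [hm, Affine.Point.map_some] at this
        simpa [Affine.Point.some.injEq] using this
      obtain ⟨T₁, hT₁, hx₁⟩ := IntermediateField.exists_finset_of_mem_adjoin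
        (hcoordI x₁ fun τ hτ ↦ (hfix τ hτ).1)
      obtain ⟨T₂, hT₂, hy₁⟩ := IntermediateField.exists_finset_of_mem_adjoin
        (hcoordI y₁ fun τ hτ ↦ (hfix τ hτ).2)
      refine ⟨T₁ ∪ T₂, by rw [Finset.coe_union]; exact Set.union_subset hT₁ hT₂, ?_⟩
      rintro z ⟨x, y, h, he, hz⟩
      simp only [Affine.Point.some.injEq] at he
      obtain ⟨rfl, rfl⟩ := he
      rw [Finset.coe_union]
      rcases hz with rfl | rfl
      · exact IntermediateField.adjoin.mono _ _ _ Set.subset_union_left hx₁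
      · exact IntermediateField.adjoin.mono _ _ _ Set.subset_union_right hy₁
  have hTroot : ∀ ζ ∈ T, ∃ N : ℕ, IsUnit ((N : ℕ) : 𝒪[(v.adicCompletion K)]) ∧ ζ ^ N = 1 := fun ζ hζ ↦ hTsub hζ
  choose! Nf hNf using hTroot
  set N₀ : ℕ := ∏ ζ ∈ T, Nf ζ with hN₀def
  have hN₀unit : IsUnit ((N₀ : ℕ) : 𝒪[(v.adicCompletion K)]) := by
    rw [hN₀def, Nat.cast_prod]
    exact IsUnit.prod_iff.mpr fun ζ hζ ↦ (hNf ζ hζ).1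
  have hTpow : ∀ ζ ∈ T, ζ ^ N₀ = 1 := fun ζ hζ ↦ by
    obtain ⟨c, hc⟩ := Finset.dvd_prod_of_mem Nf hζ
    rw [hN₀def, hc, pow_mul, (hNf ζ hζ).2, one_pow]
  -- (c) `q` is prime to `N₀`, so `N₀ ∣ q^t - 1` for `t = φ(N₀)`
  obtain ⟨hN₀pos, hpN₀⟩ := pos_and_not_ringChar_dvd_of_isUnit_natCast hN₀unit
  have hcop : Nat.Coprime (Nat.card (IsLocalRing.ResidueField (v.adicCompletionIntegers K))) N₀ := by
    obtain ⟨f, -, hf⟩ := residueFieldCard_eq_pow_ringChar (F := (v.adicCompletion K))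
    rw [WeierstrassCurve.natCard_residueField_eq_residueCard,
      ← Literature.NumberTheory.Automorphic.residueFieldCard_adicCompletion_eq K v, hf]
    refine Nat.Coprime.pow_left f ?_
    letI := Fintype.ofFinite 𝓀[(v.adicCompletion K)]
    obtain ⟨_, hp, _⟩ := FiniteField.card 𝓀[(v.adicCompletion K)] (ringChar 𝓀[(v.adicCompletion K)])
    exact (Nat.Prime.coprime_iff_not_dvd hp).mpr hpN₀
  set t : ℕ := Nat.totient N₀ with htdef
  have htpos : 0 < t := Nat.totient_pos.mpr hN₀pos
  set n : ℕ := m₀ * t with hndef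
  have hn : n ≠ 0 := Nat.mul_ne_zero hm₀pos.ne' htpos.ne'
  have h1qn : 1 ≤ (Nat.card (IsLocalRing.ResidueField (v.adicCompletionIntegers K))) ^ n := Nat.one_le_pow _ _ (by omega)
  have hN₀dvd : N₀ ∣ (Nat.card (IsLocalRing.ResidueField (v.adicCompletionIntegers K))) ^ n - 1 := by
    have h1 : (Nat.card (IsLocalRing.ResidueField (v.adicCompletionIntegers K))) ^ t ≡ 1 [MOD N₀] := Nat.ModEq.pow_totient hcop
    have h2 : (Nat.card (IsLocalRing.ResidueField (v.adicCompletionIntegers K))) ^ n ≡ 1 [MOD N₀] := by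
      rw [hndef, mul_comm, pow_mul]
      simpa using h1.pow m₀
    exact (Nat.modEq_iff_dvd' h1qn).mp h2.symm
  have hg₁Fn : g₁ (F ^ n) = 0 := hFpow t
  -- (d) the layer `K_n = K_v(ζ)`, `ζ` a primitive `(qⁿ - 1)`-th root of unity
  obtain ⟨ζ, hζ⟩ := exists_isPrimitiveRoot_residueCard_pow_sub_one (v := v) hn
  have hm0 : (Nat.card (IsLocalRing.ResidueField (v.adicCompletionIntegers K))) ^ n - 1 ≠ 0 := by
    have : 1 < (Nat.card (IsLocalRing.ResidueField (v.adicCompletionIntegers K))) ^ n := Nat.one_lt_pow hn (by omega)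
    omega
  have hmw : w (((Nat.card (IsLocalRing.ResidueField (v.adicCompletionIntegers K))) ^ n - 1 : ℕ) : (AlgebraicClosure (v.adicCompletion K))) = 1 := spectralValuation_natCast_residueCard_pow_sub_one hw hn
  have hζpow : ζ ^ ((Nat.card (IsLocalRing.ResidueField (v.adicCompletionIntegers K))) ^ n - 1) = 1 := hζ.pow_eq_one
  set Kn : IntermediateField (v.adicCompletion K) (AlgebraicClosure (v.adicCompletion K)) := IntermediateField.adjoin (v.adicCompletion K) {ζ} with hKndef
  have hTKn : ∀ z ∈ T, z ∈ Kn := by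
    intro z hz
    haveI : NeZero ((Nat.card (IsLocalRing.ResidueField (v.adicCompletionIntegers K))) ^ n - 1) := ⟨hm0⟩
    have hz1 : z ^ ((Nat.card (IsLocalRing.ResidueField (v.adicCompletionIntegers K))) ^ n - 1) = 1 := by
      obtain ⟨c, hc⟩ := hN₀dvd
      rw [hc, pow_mul, hTpow z hz, one_pow]
    obtain ⟨i, -, rfl⟩ := hζ.eq_pow_of_pow_eq_one hz1
    exact pow_mem (IntermediateField.mem_adjoin_simple_self (v.adicCompletion K) ζ) i
  have hadjT : IntermediateField.adjoin (v.adicCompletion K) (↑T : Set (AlgebraicClosure (v.adicCompletion K))) ≤ Kn :=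
    IntermediateField.adjoin_le_iff.mpr fun z hz ↦ hTKn z hz
  have hm₁R : m₁ ∈ (Affine.Point.map (W' := M.map (algebraMap (v.adicCompletionIntegers K) (v.adicCompletion K)))
      (IntermediateField.val Kn)).range := by
    rcases hm : m₁ with _ | ⟨x₁, y₁, h₁⟩
    · exact ⟨0, by rw [map_zero]; rfl⟩
    · exact mem_range_map_val h₁ (hadjT (hTgen x₁ ⟨x₁, y₁, h₁, hm, Or.inl rfl⟩))
        (hadjT (hTgen y₁ ⟨x₁, y₁, h₁, hm, Or.inr rfl⟩))
  -- the Frobenius on the layer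
  have hFζ : F • ζ = ζ ^ (Nat.card (IsLocalRing.ResidueField (v.adicCompletionIntegers K))) := frobenius_smul_eq_pow_of_pow_eq_one hw h𝔐 hF hm0 hmw hζpow
  have hFK : ∀ x : Kn, (((absoluteGaloisGroup.toAlgEquiv (v.adicCompletion K)) F : (AlgebraicClosure (v.adicCompletion K)) ≃ₐ[(v.adicCompletion K)] (AlgebraicClosure (v.adicCompletion K))) : (AlgebraicClosure (v.adicCompletion K)) →ₐ[(v.adicCompletion K)] (AlgebraicClosure (v.adicCompletion K))) x ∈ Kn := fun x ↦
    smul_mem_adjoin_of_smul_eq_pow hFζ x.2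
  have hFnζ : F ^ n • ζ = ζ := (frobenius_pow_smul_eq_self_iff hw h𝔐 hF hn hζ n).mpr dvd_rfl
  have hFn : ∀ x : Kn, ((((absoluteGaloisGroup.toAlgEquiv (v.adicCompletion K)) F : (AlgebraicClosure (v.adicCompletion K)) ≃ₐ[(v.adicCompletion K)] (AlgebraicClosure (v.adicCompletion K))) : (AlgebraicClosure (v.adicCompletion K)) →ₐ[(v.adicCompletion K)] (AlgebraicClosure (v.adicCompletion K))) ^ n) x = x := fun x ↦ by
    rw [coe_gal_pow]
    exact algHom_apply_eq_self_of_mem_adjoin hm0 hζpow _ hFnζ x.2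
  -- Step 3: successive approximation on `V₁(K_n)`
  obtain ⟨ϖ, hϖ⟩ := IsDiscreteValuationRing.exists_irreducible (v.adicCompletionIntegers K)
  obtain ⟨hρ0, hρ1⟩ := spectralValuation_uniformizer_pos_lt_one hw hϖ
  have hsum : ∑ j ∈ Finset.range n, Affine.Point.map ((((absoluteGaloisGroup.toAlgEquiv (v.adicCompletion K)) F : (AlgebraicClosure (v.adicCompletion K)) ≃ₐ[(v.adicCompletion K)] (AlgebraicClosure (v.adicCompletion K))) : (AlgebraicClosure (v.adicCompletion K)) →ₐ[(v.adicCompletion K)] (AlgebraicClosure (v.adicCompletion K))) ^ j) m₁ = 0 := by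
    rw [← hg₁Fn, cocycle_apply_pow hg₁ F n]
    exact Finset.sum_congr rfl fun j _ ↦ map_gal_pow F j m₁
  obtain ⟨Q, hQK, hQR, hQF⟩ := exists_map_sub_eq_of_sum_eq_zero
    (X := M.map (algebraMap (v.adicCompletionIntegers K) (v.adicCompletion K))) (Kn := Kn)
    (F := (((absoluteGaloisGroup.toAlgEquiv (v.adicCompletion K)) F : (AlgebraicClosure (v.adicCompletion K)) ≃ₐ[(v.adicCompletion K)] (AlgebraicClosure (v.adicCompletion K))) : (AlgebraicClosure (v.adicCompletion K)) →ₐ[(v.adicCompletion K)] (AlgebraicClosure (v.adicCompletion K)))) (n := n) hFw hFK hFn (π := (ϖ : (v.adicCompletion K))) rfl hρ0 hρ1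
    (fun x hx ↦ spectralValuation_le_uniformizer_of_mem_adjoin hw h𝔐 hm0 hmw hζpow hϖ x.2 hx)
    (fun a ha htr ↦ by
      obtain ⟨t', ht'mem, ht'1, ht'⟩ := exists_frob_sub_sub_lt_one hw hφq hn hζ ha (by
        rwa [Finset.sum_congr rfl fun j _ ↦ show ((((absoluteGaloisGroup.toAlgEquiv (v.adicCompletion K)) F : (AlgebraicClosure (v.adicCompletion K)) ≃ₐ[(v.adicCompletion K)] (AlgebraicClosure (v.adicCompletion K))) : (AlgebraicClosure (v.adicCompletion K)) →ₐ[(v.adicCompletion K)] (AlgebraicClosure (v.adicCompletion K))) ^ j) (a : (AlgebraicClosure (v.adicCompletion K))) =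
          (absoluteGaloisGroup.toAlgEquiv (v.adicCompletion K)) (F ^ j) a by rw [coe_gal_pow]; rfl] at htr)
      exact ⟨⟨t', ht'mem⟩, ht'1, ht'⟩)
    (fun z hz ↦ by
      obtain ⟨P, hPK, hPz, hPfix⟩ := exists_mem_kernel_zCoord_eq (w := w)
        (M.map (algebraMap (v.adicCompletionIntegers K) (v.adicCompletion K))) hz
      refine ⟨P, hPK, ?_, hPz⟩
      -- coordinates of `P` lie in `K_n`, by descent
      rcases hP : P with _ | ⟨x, y, h⟩
      · exact ⟨0, by rw [map_zero]; rfl⟩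
      · have hdesc : ∀ u : (AlgebraicClosure (v.adicCompletion K)), (u = x ∨ u = y) → u ∈ Kn := by
          intro u hu
          refine mem_adjoin_of_forall_smul_eq fun σ hσ ↦ ?_
          have hσz : (absoluteGaloisGroup.toAlgEquiv (v.adicCompletion K)) σ (z : (AlgebraicClosure (v.adicCompletion K))) = z :=
            algHom_apply_eq_self_of_mem_adjoin hm0 hζpow (((absoluteGaloisGroup.toAlgEquiv (v.adicCompletion K)) σ : (AlgebraicClosure (v.adicCompletion K)) ≃ₐ[(v.adicCompletion K)] (AlgebraicClosure (v.adicCompletion K))) : (AlgebraicClosure (v.adicCompletion K)) →ₐ[(v.adicCompletion K)] (AlgebraicClosure (v.adicCompletion K))) hσ z.2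
          have hσP := hPfix ((absoluteGaloisGroup.toAlgEquiv (v.adicCompletion K)) σ) (hσw σ) hσz
          rw [hP, Affine.Point.map_some] at hσP
          simp only [Affine.Point.some.injEq] at hσP
          rcases hu with rfl | rfl
          · exact hσP.1
          · exact hσP.2
        exact mem_range_map_val h (hdesc x (Or.inl rfl)) (hdesc y (Or.inr rfl)))
    (fun x hx ↦ exists_limit_of_mem_adjoin hw hm0 hζpow hρ1 x hx)
    hm₁K hm₁R hsum
  -- Step 4: `g₂ = g₁ - ∂Q` vanishes on `I` and at `F`, hence everywhere
  set g₂ : absoluteGaloisGroup (v.adicCompletion K) → (((M.map (algebraMap (v.adicCompletionIntegers K) (v.adicCompletion K))).baseChange (AlgebraicClosure (v.adicCompletion K)))).toAffine.Point := fun σ ↦ g₁ σ - (WeierstrassCurve.Affine.Point.map (W' := M.map (algebraMap (v.adicCompletionIntegers K) (v.adicCompletion K))) ((absoluteGaloisGroup.toAlgEquiv (v.adicCompletion K) (σ) : AlgebraicClosure (v.adicCompletion K) ≃ₐ[v.adicCompletion K] AlgebraicClosure (v.adicCompletion K)) : AlgebraicClosure (v.adicCompletion K) →ₐ[v.adicCompletion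 K] AlgebraicClosure (v.adicCompletion K)) Q - Q) with hg₂def
  have hg₂ : ∀ σ τ, g₂ (σ * τ) = g₂ σ + WeierstrassCurve.Affine.Point.map (W' := M.map (algebraMap (v.adicCompletionIntegers K) (v.adicCompletion K))) ((absoluteGaloisGroup.toAlgEquiv (v.adicCompletion K) (σ) : AlgebraicClosure (v.adicCompletion K) ≃ₐ[v.adicCompletion K] AlgebraicClosure (v.adicCompletion K)) : AlgebraicClosure (v.adicCompletion K) →ₐ[v.adicCompletion K] AlgebraicClosure (v.adicCompletion K)) (g₂ τ) := cocycle_sub_coboundary hg₁ Q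
  have hg₂F : g₂ F = 0 := by
    simp only [hg₂def]
    rw [sub_eq_zero]
    exact hQF.symm
  have hg₂I : ∀ τ ∈ 𝔐.inertia (absoluteGaloisGroup (v.adicCompletion K)), g₂ τ = 0 := by
    intro τ hτ
    have hτζ : τ • ζ = ζ := smul_eq_self_of_mem_inertia_of_pow_eq_one hw h𝔐 hτ hm0 hmw hζpow
    have hτQ : WeierstrassCurve.Affine.Point.map (W' := M.map (algebraMap (v.adicCompletionIntegers K) (v.adicCompletion K))) ((absoluteGaloisGroup.toAlgEquiv (v.adicCompletion K) (τ) : AlgebraicClosure (v.adicCompletion K) ≃ₐ[v.adicCompletion K] AlgebraicClosure (v.adicCompletion K)) : AlgebraicClosure (v.adicCompletion K) →ₐ[v.adicCompletion K] AlgebraicClosure (v.adicCompletion K)) Q = Q := map_eq_self_of_mem_range _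
      (fun x hx ↦ algHom_apply_eq_self_of_mem_adjoin hm0 hζpow _ hτζ hx) hQR
    simp only [hg₂def, hg₁I τ hτ, hτQ, sub_self]
  have hg₂open : IsOpen {σ | g₂ σ = 0} := isOpen_setOf_sub_coboundary_eq_zero hg₁ hg₁open Q
  obtain ⟨U, hU⟩ := exists_subgroup_coe_eq_setOf hg₂
  have hUtop : U = ⊤ := by
    refine eq_top_of_isOpen_of_frobenius_mem_of_inertia_le v h𝔐 hF (by rw [hU]; exact hg₂open) ?_ ?_
    · change F ∈ (U : Set (absoluteGaloisGroup (v.adicCompletion K))); rw [hU]; exact hg₂F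
    · intro τ hτ; change τ ∈ (U : Set (absoluteGaloisGroup (v.adicCompletion K))); rw [hU]; exact hg₂I τ hτ
  have hg₂zero : ∀ σ, g₂ σ = 0 := fun σ ↦ by
    have : σ ∈ (U : Set (absoluteGaloisGroup (v.adicCompletion K))) := by rw [hUtop]; trivial
    rwa [hU] at this
  refine ⟨b + Q, fun σ ↦ ?_⟩
  have := hg₂zero σ
  simp only [hg₂def, hg₁def, sub_eq_zero] at this
  rw [map_add]
  -- `g σ - (σb - b) = σQ - Q`
  have e : g σ = (WeierstrassCurve.Affine.Point.map (W' := M.map (algebraMap (v.adicCompletionIntegers K) (v.adicCompletion K))) ((absoluteGaloisGroup.toAlgEquiv (v.adicCompletion K) (σ) : AlgebraicClosure (v.adicCompletion K) ≃ₐ[v.adicCompletion K] AlgebraicClosure (v.adicCompletion K)) : AlgebraicClosure (v.adicCompletion K) →ₐ[v.adicCompletion K] AlgebraicClosure (v.adicCompletion K)) b - b) + (WeierstrassCurve.Affine.Point.map (W' := M.map (algebraMap (v.adicCompletionIntegers K) (v.adicCompletion K))) ((absoluteGaloisGroup.toAlgEquiv (v.adicCompletion K) (σ) : AlgebraicClosure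 (v.adicCompletion K) ≃ₐ[v.adicCompletion K] AlgebraicClosure (v.adicCompletion K)) : AlgebraicClosure (v.adicCompletion K) →ₐ[v.adicCompletion K] AlgebraicClosure (v.adicCompletion K)) Q - Q) := by rw [← this]; abel
  rw [e]; abel



end Summit.BirchSwinnertonDyer.Rank1Residual.GaloisImage.TwistedWitness

end
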